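import Mathlib
import HarnessLib
import Summits.Ventures.LatticeQCDFlow.Exactness.IMHAcceptanceGeHalfESS
import Summits.Ventures.LatticeQCDFlow.Scaling.AcceptanceEssEightNinthsIntegral

/-!
# LatticeQCDFlow / Scaling — `acc ≥ (8/9)·ESS` on a GENERAL measure space, II: row 2's densities
# `∫ (1 − λ(b)) w dμ ≥ (8/9)·Z³/W₂`, i.e. `ā ≥ (8/9)·κ` (the tree had `ā ≥ κ/2`)

HONEST FRAMING: exact (Metropolis-corrected) sampling algorithms for lattice gauge theory;
figures of merit are autocorrelation/cost numbers at stated couplings and volumes; no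
continuum-physics claim.

Venture `LatticeQCDFlow` (cell pub-lqcd), topic `Scaling`; FANOUT row 3 (`s0-u1-a`, S0-B
implementation A, GEN-9).  NEW WORK of the cell, not a published result; NO definition is
introduced.  SHARPENS row 2's `Exactness/IMHAcceptanceGeHalfESS.lean` (`meanAccept_ge_half_ESS`:
`ā ≥ κ/2`, two tangent-line Jensen steps) to the best constant `ā ≥ (8/9)·κ` in exactly its
setting and vocabulary, by specialising Part I (`Scaling/AcceptanceEssEightNinthsIntegral.lean`,
the layer-cake core in `ℝ≥0∞`) to `b = w/q`, `ρ = q` and converting the three moments back to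
Bochner integrals (row 2's `integrable_min_mul`, `integrable_integral_min_mul`, `meanAccept_eq`,
`integrable_rejCurve_integrand`, `integral_pos_of_pos` are reused, nothing is restated).

## What is proved (`(X, μ)` s-finite; `w, q > 0` measurable, `w` integrable, `∫ q dμ = 1`,
## `Z = ∫ w dμ`, `b = w/q`, `W₂ = ∫ b w dμ < ∞`, `κ = Z²/W₂`, `λ = rejCurve μ w q`)

* **`eight_ninths_le_integral_integral_min_mul`** — `(8/9)·Z³/W₂ ≤ ∫∫ min(w(x)q(y), w(y)q(x))`;
* **`meanAccept_ge_eight_ninths_ESS`** — `(8/9)·Z³/W₂ ≤ ∫ (1 − λ(b)) w dμ`, i.e. the equilibrium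
  acceptance `ā = E_π[1 − λ(b)] ≥ (8/9)·κ` (row 2: `≥ κ/2`);
* `meanAccept_overlapForm_ge_eight_ninths_ESS` — with `p = w/Z`:
  `∫∫ min(p(x)q(y), p(y)q(x)) ≥ (8/9)·Z²/W₂`;
* **`phi4Flow_meanAccept_ge_eight_ninths_ESS`** — the lattice φ⁴ flow sampler of row 2
  (`λ > 0`, any real `J`, positive measurable model density `q̃`, `∫ q̃ = 1`, `W₂ < ∞`).

Reading for S0-A/S0-B (no numerics implied): the consistency check between the acceptance and
ESS columns of an exact flow sampler is `ā ≥ (8/9)·κ̂` up to statistical error (`κ̂ = 0.3` forces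
`ā ≥ 0.267`; row 2's floor gave `0.15`), on a general state space exactly as on a finite one.
The constant is attained (`Scaling/AcceptanceEssEightNinthsIntegralWitness.lean`: Lebesgue measure
on `(0, 1]`, `q̃ ≡ 1`, `w(t) = t`: `ā = 2/3`, `κ = 3/4`).  NOT CLAIMED: an upper bound on `ā` by
`κ` (none exists: row 3's `Scaling/AcceptanceEssNoCeiling`); anything out of equilibrium; any
number for a trained network; nothing re-scored.
-/

namespace Summit.Ventures.LatticeQCDFlow.Theory2

open MeasureTheory ENNReal Set
open Summit.Ventures.LatticeQCDFlow.Exactness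

/-! ### Row 2's setting: real densities `w, q > 0` on `(X, μ)` -/

section Densities

variable {X : Type*} [MeasurableSpace X] {μ : Measure X} [SFinite μ] {w q : X → ℝ}

/-- **`(8/9)·Z³/W₂ ≤ ∫∫ min(w(x)q(y), w(y)q(x))`** — the unnormalised overlap form: for
measurable `w, q > 0` with `w` integrable, `∫ q dμ = 1` and `W₂ = ∫ (w/q)·w dμ < ∞`, `Z = ∫ w dμ`. -/
theorem eight_ninths_le_integral_integral_min_mul (hw0 : ∀ t, 0 < w t) (hwm : Measurable w)
    (hwi : Integrable w μ) (hq0 : ∀ t, 0 < q t) (hqm : Measurable q) (hqi : Integrable q μ)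
    (hq1 : ∫ z, q z ∂μ = 1) (hW₂ : Integrable (fun x => w x / q x * w x) μ) :
    8 * (∫ z, w z ∂μ) ^ 3 / (9 * ∫ z, w z / q z * w z ∂μ)
      ≤ ∫ x, ∫ y, min (w x * q y) (w y * q x) ∂μ ∂μ := by
  set Z : ℝ := ∫ z, w z ∂μ with hZdef
  set W : ℝ := ∫ z, w z / q z * w z ∂μ with hWdef
  have hZ : 0 < Z := integral_pos_of_pos hw0 hwi hq1
  have hb0 : ∀ x, 0 ≤ w x / q x := fun x => (div_pos (hw0 x) (hq0 x)).le
  have hW : 0 < W := integral_pos_of_pos (fun x => mul_pos (div_pos (hw0 x) (hq0 x)) (hw0 x)) hW₂ hq1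
  -- the three moments of the core, in real form
  have hm1 : ∫⁻ x, ENNReal.ofReal (w x / q x) * ENNReal.ofReal (q x) ∂μ = ENNReal.ofReal Z := by
    rw [hZdef, ofReal_integral_eq_lintegral_ofReal hwi (Filter.Eventually.of_forall fun x => (hw0 x).le)]
    refine lintegral_congr fun x => ?_
    rw [← ENNReal.ofReal_mul (hb0 x), div_mul_cancel₀ _ (hq0 x).ne']
  have hm2 : ∫⁻ x, ENNReal.ofReal ((w x / q x) ^ 2) * ENNReal.ofReal (q x) ∂μ = ENNReal.ofReal W := by
    rw [hWdef, ofReal_integral_eq_lintegral_ofReal hW₂ (Filter.Eventually.of_forall fun x =>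
      (mul_pos (div_pos (hw0 x) (hq0 x)) (hw0 x)).le)]
    refine lintegral_congr fun x => ?_
    rw [← ENNReal.ofReal_mul (sq_nonneg _)]
    congr 1
    have hqx := (hq0 x).ne'
    field_simp
  have hmin0 : ∀ x y, 0 ≤ min (w x * q y) (w y * q x) := fun x y =>
    le_min (mul_nonneg (hw0 x).le (hq0 y).le) (mul_nonneg (hw0 y).le (hq0 x).le)
  have hA : ∫⁻ x, ∫⁻ y, ENNReal.ofReal (min (w x / q x) (w y / q y)) * ENNReal.ofReal (q x)
        * ENNReal.ofReal (q y) ∂μ ∂μ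
      = ENNReal.ofReal (∫ x, ∫ y, min (w x * q y) (w y * q x) ∂μ ∂μ) := by
    rw [ofReal_integral_eq_lintegral_ofReal (integrable_integral_min_mul (fun x => (hw0 x).le) hwm
      hwi (fun x => (hq0 x).le) hqm hqi hq1) (Filter.Eventually.of_forall fun x =>
        integral_nonneg fun y => hmin0 x y)]
    refine lintegral_congr fun x => ?_
    rw [ofReal_integral_eq_lintegral_ofReal (integrable_min_mul (fun x => (hw0 x).le) hwm
      (fun x => (hq0 x).le) hqm hqi x) (Filter.Eventually.of_forall fun y => hmin0 x y)]
    refine lintegral_congr fun y => ?_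
    rw [← ENNReal.ofReal_mul (le_min (hb0 x) (hb0 y)), ← ENNReal.ofReal_mul
      (mul_nonneg (le_min (hb0 x) (hb0 y)) (hq0 x).le)]
    congr 1
    rw [min_mul_of_nonneg _ _ (hq0 x).le, min_mul_of_nonneg _ _ (hq0 y).le]
    have hqx := (hq0 x).ne'
    have hqy := (hq0 y).ne'
    congr 1
    · field_simp
    · field_simp
  have h := ofReal_eight_ninths_le_overlap (μ := μ) (b := fun x => w x / q x)
    (ρ := fun x => ENNReal.ofReal (q x)) (hwm.div hqm) hb0 hqm.ennreal_ofReal hZ hW hm1 hm2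
  rw [hA] at h
  exact (ENNReal.ofReal_le_ofReal_iff (integral_nonneg fun x => integral_nonneg fun y => hmin0 x y)).1 h

/-- **MEAN ACCEPTANCE `≥ (8/9)·κ`** (row 2's `rejCurve` form, cf. `meanAccept_ge_half_ESS`):
`∫ (1 − λ(b)) w dμ ≥ (8/9)·Z³/W₂`, i.e. the equilibrium acceptance `ā = E_π[1 − λ(b)]` of the exact
flow / independence sampler is at least `(8/9)·Z²/W₂ = (8/9)·κ`. -/
theorem meanAccept_ge_eight_ninths_ESS (hw0 : ∀ t, 0 < w t) (hwm : Measurable w)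
    (hwi : Integrable w μ) (hq0 : ∀ t, 0 < q t) (hqm : Measurable q) (hqi : Integrable q μ)
    (hq1 : ∫ z, q z ∂μ = 1) (hW₂ : Integrable (fun x => w x / q x * w x) μ) :
    8 * (∫ z, w z ∂μ) ^ 3 / (9 * ∫ z, w z / q z * w z ∂μ)
      ≤ ∫ x, (1 - rejCurve μ w q (w x / q x)) * w x ∂μ := by
  have h := eight_ninths_le_integral_integral_min_mul hw0 hwm hwi hq0 hqm hqi hq1 hW₂
  rw [meanAccept_eq hw0 hq0] at h
  have hinner : ∀ x, ∫ y, min 1 (w y * q x / (w x * q y)) * q y ∂μ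
      = 1 - rejCurve μ w q (w x / q x) := by
    intro x
    have hb0 : 0 < w x / q x := div_pos (hw0 x) (hq0 x)
    have hint := integrable_rejCurve_integrand hw0 hwm hq0 hqm hqi hb0 (μ := μ)
    have e : ∀ y, min 1 (w y * q x / (w x * q y)) * q y
        = q y - (1 - min 1 (w y / q y / (w x / q x))) * q y := by
      intro y
      have hqy := (hq0 y).ne'
      have hqx := (hq0 x).ne'
      have hwx := (hw0 x).ne'
      have e1 : w y * q x / (w x * q y) = w y / q y / (w x / q x) := by
        field_simp
      rw [e1]
      ring
    simp_rw [e]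
    rw [integral_sub hqi hint, hq1]
    rfl
  simp_rw [hinner] at h
  exact h

/-- **`ā ≥ (8/9)·κ` in the normalised overlap form** of `FlowAcceptanceOverlap.lean`: with
`p = w/Z`, `∫∫ min(p(x)q(y), p(y)q(x)) dμ dμ ≥ (8/9)·Z²/W₂`. -/
theorem meanAccept_overlapForm_ge_eight_ninths_ESS (hw0 : ∀ t, 0 < w t) (hwm : Measurable w)
    (hwi : Integrable w μ) (hq0 : ∀ t, 0 < q t) (hqm : Measurable q) (hqi : Integrable q μ)
    (hq1 : ∫ z, q z ∂μ = 1) (hW₂ : Integrable (fun x => w x / q x * w x) μ) :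
    8 * (∫ z, w z ∂μ) ^ 2 / (9 * ∫ z, w z / q z * w z ∂μ)
      ≤ ∫ x, ∫ y, min (w x / (∫ z, w z ∂μ) * q y) (w y / (∫ z, w z ∂μ) * q x) ∂μ ∂μ := by
  set Z : ℝ := ∫ z, w z ∂μ with hZdef
  have hZ : 0 < Z := integral_pos_of_pos hw0 hwi hq1
  have h := eight_ninths_le_integral_integral_min_mul hw0 hwm hwi hq0 hqm hqi hq1 hW₂
  rw [← hZdef] at h
  have e : ∀ x, ∫ y, min (w x / Z * q y) (w y / Z * q x) ∂μ
      = (∫ y, min (w x * q y) (w y * q x) ∂μ) / Z := by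
    intro x
    rw [← integral_div]
    refine integral_congr_ae (Filter.Eventually.of_forall fun y => ?_)
    show min (w x / Z * q y) (w y / Z * q x) = min (w x * q y) (w y * q x) / Z
    rw [← min_div_div_right hZ.le]
    congr 1 <;> ring
  simp_rw [e]
  rw [integral_div, le_div_iff₀ hZ]
  have hW : 0 < ∫ z, w z / q z * w z ∂μ :=
    integral_pos_of_pos (fun x => mul_pos (div_pos (hw0 x) (hq0 x)) (hw0 x)) hW₂ hq1
  calc 8 * Z ^ 2 / (9 * ∫ z, w z / q z * w z ∂μ) * Z = 8 * Z ^ 3 / (9 * ∫ z, w z / q z * w z ∂μ) := by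
        field_simp
    _ ≤ _ := h

end Densities

/-! ### The lattice: row 2's φ⁴ flow sampler -/

section Lattice

open Summit.Ventures.LatticeQCDFlow.Scoring

variable {n : ℕ}

/-- **`ā ≥ (8/9)·κ` FOR THE φ⁴ FLOW SAMPLER** (sharpening row 2's
`phi4Flow_meanAccept_ge_half_ESS`): every `λ > 0`, real `J`, positive measurable model density
`q̃` with `∫ q̃ = 1` and `W₂ = ∫ (e^{−S}/q̃) e^{−S} < ∞`; with `p = e^{−S}/Z`:
`∫∫ min(p(φ)q̃(φ'), p(φ')q̃(φ)) ≥ (8/9)·Z²/W₂`. -/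
theorem phi4Flow_meanAccept_ge_eight_ninths_ESS {lam : ℝ} (hlam : 0 < lam)
    (J : Fin (n + 1) → Fin (n + 1) → ℝ) {q : (Fin (n + 1) → ℝ) → ℝ} (hq0 : ∀ φ, 0 < q φ)
    (hqm : Measurable q) (hqi : Integrable q) (hq1 : ∫ φ, q φ = 1)
    (hW₂ : Integrable (fun φ => gibbsWeight J lam φ / q φ * gibbsWeight J lam φ)) :
    8 * (∫ φ, gibbsWeight J lam φ) ^ 2 / (9 * ∫ φ, gibbsWeight J lam φ / q φ * gibbsWeight J lam φ)
      ≤ ∫ φ, ∫ φ', min (gibbsWeight J lam φ / (∫ ψ, gibbsWeight J lam ψ) * q φ')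
          (gibbsWeight J lam φ' / (∫ ψ, gibbsWeight J lam ψ) * q φ) :=
  meanAccept_overlapForm_ge_eight_ninths_ESS (μ := volume) (fun ψ => gibbsWeight_pos J lam ψ)
    (continuous_gibbsWeight J lam).measurable (integrable_gibbsWeight hlam J) hq0 hqm hqi hq1 hW₂

end Lattice

end Summit.Ventures.LatticeQCDFlow.Theory2
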